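import Summits.ValiantsHypothesis.ValiantsHypothesis.Theorems.NcParseTrees
import HarnessLib

/-!
# Parse trees of noncommutative circuits: soundness, filtered values, slot typing

LLS18 = Lagarde–Limaye–Srinivasan 2018. THIS FILE (no definitions): (§1) SOUNDNESS — a circuit
whose product gates have fan-in 1 or 2 and which has no `const` operand computes the sum of the
terms of its parse trees (`ptVal_circuitPts`, LLS18 §2 «the polynomial computed by C is the sum
over its parse formulas»); (§2) the algebra of FILTERED values `ptValAt rot S` — additivity,
scalars, and the PRODUCT RULE at a node `(l, r)` (`ptValAt_pairPts_node`): the pairs filter into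
`V_L(l)·V_M(r)` plus, with rotations and only when `l ≁ r`, `V_L(r)·V_M(l)` (when `l ∼ r` the
two cases coincide — `∼` is an equivalence — and must not be counted twice); (§3) the slot
types `nfTy` and the typing of converted operands / product slots / sum slots.
MODEL: PRINT rotUPT (LLS18 §4) for a circuit P in the tree's syntax := every PARSE TREE of P —
obtained by keeping one summand of every sum gate and both factors of every product gate, recorded
as (shape, coefficient•monomial) — has a shape that is a ROTATION (rotSim true) of one shape T;
PRINT UPT := every parse tree has shape T. Formalised for circuits whose product gates have fan-in
1 or 2 (copies and binary products; weighted sums of any fan-in; NO `const` operands — in print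
constants live on the + wires only, LLS18 p. 7); product fan-in ≥ 3 (allowed in print, removed by
LLS18 Lemma 8) is NOT covered (= option (c)); `nfConv rot T P` is GateRot-typed by T (GateTyped for
rot = false) UNCONDITIONALLY and computes the sum of those parse trees of P whose shape is ∼ T —
hence P.ncEval itself exactly when P is print-rotUPT of class [[T]]; size 3(2|T|−1)(P.size+1). The
transfers' constants (LID_r: 2^((r+1)/3) ≤ 96·r·r·(s+1); PERM_(4r): same; print-UPT: 2^(r+1) ≤
24·r·(s+1)) are WEAKER than lidPoly_rot / ncPerPoly_rot / ncPerPoly_upt — the content is the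
factorisation print-rotUPT → rot-NF → lidPoly_rot. NOT a new lower bound; 0 S-currency;
closes NO item; A_nc stmt-23446 / PerNotNcVP / VP ≠ VNP untouched.
NON-VACUOUS (K6): `circuitPts_P0` lists the parse-tree shapes of `P₀ = xyz + zxy` (gates
`x·y`, `g₀·z`, `z·g₀`, `g₁ + g₂`; no const operand, products binary): the two combs
`((xy)z)` and `(z(xy))`, rotations of each other and distinct — `P₀` is print-rotUPT of class
`[[node (node leaf leaf) leaf]]` and NOT print-UPT.
[cite: LagardeLimayeSrinivasan2018, §2, §3 Proposition 7, §4] [cite: LimayeMalodSrinivasan2016, §7]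
[cite: ArvindRaja2016, §5]
-/

noncomputable section

namespace Summit.ValiantsHypothesis.ValiantsHypothesis.Theorems.NcParseTreeValues

set_option linter.dupNamespace false
open Literature.Computability.AlgebraicComplexity
  Literature.Computability.AlgebraicComplexity.ArithCircuit
  Summit.ValiantsHypothesis.ValiantsHypothesis.Theorems.NcAutomatonIntersection
  Summit.ValiantsHypothesis.ValiantsHypothesis.Theorems.NcUniqueParseTree
  Summit.ValiantsHypothesis.ValiantsHypothesis.Theorems.NcRotParseTree
  Summit.ValiantsHypothesis.ValiantsHypothesis.Theorems.NcSkewCombTypedPermanent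
  Summit.ValiantsHypothesis.ValiantsHypothesis.Theorems.NcParseTrees

universe u v

variable {R : Type u} [CommSemiring R] {σ : Type v}

/-! ### §1 Soundness: the circuit computes the sum of its parse trees (LLS18 §2) -/

/-- Values add under concatenation. [cite: LagardeLimayeSrinivasan2018, §2] -/
theorem ptVal_append (L M : List (Shape × FreeAlgebra R σ)) :
    ptVal (L ++ M) = ptVal L + ptVal M := by
  simp [ptVal, List.map_append, List.sum_append]

/-- Values are linear in the weights. [cite: LagardeLimayeSrinivasan2018, §2] -/
theorem ptVal_map_smul (c : R) (L : List (Shape × FreeAlgebra R σ)) :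
    ptVal (L.map fun e => (e.1, c • e.2)) = c • ptVal L := by
  induction L with
  | nil => simp [ptVal]
  | cons e L ih =>
    simp only [ptVal, List.map_cons, List.sum_cons] at ih ⊢
    rw [ih, smul_add]

/-- The pairs multiply (ordered). [cite: LagardeLimayeSrinivasan2018, §2] -/
theorem ptVal_pairPts (L M : List (Shape × FreeAlgebra R σ)) :
    ptVal (pairPts L M) = ptVal L * ptVal M := by
  induction L with
  | nil => simp [pairPts, ptVal]
  | cons e L ih =>
    have h : ptVal (M.map fun f => (Shape.node e.1 f.1, e.2 * f.2)) = e.2 * ptVal M := by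
      simp only [ptVal, List.map_map, Function.comp_def]
      exact List.sum_map_mul_left M Prod.snd e.2
    rw [pairPts, ptVal_append, ih, h]
    simp only [ptVal, List.map_cons, List.sum_cons, add_mul]

/-- Operands: value = sum of parse trees (no constants). [cite: LagardeLimayeSrinivasan2018, §2] -/
theorem ptVal_opPts {W : List (List (Shape × FreeAlgebra R σ))} {vals : List (FreeAlgebra R σ)}
    (hW : ∀ j, ptVal (W.getD j []) = vals.getD j 0) (u : Operand R σ)
    (hu : ∀ c, u ≠ Operand.const c) : ptVal (opPts W u) = u.ncEval vals := by
  cases u with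
  | var x => simp [opPts, ptVal, Operand.ncEval]
  | const c => exact absurd rfl (hu c)
  | gate j => simpa [opPts, Operand.ncEval] using hW j

/-- Helper: weighted sums of operands. [cite: LagardeLimayeSrinivasan2018, §2] -/
theorem ptVal_sumPts {W : List (List (Shape × FreeAlgebra R σ))} {vals : List (FreeAlgebra R σ)}
    (hW : ∀ j, ptVal (W.getD j []) = vals.getD j 0) (args : List (R × Operand R σ))
    (hc : ∀ a ∈ args, ∀ c, a.2 ≠ Operand.const c) :
    ptVal (sumPts W args) = (args.map fun a => a.1 • a.2.ncEval vals).sum := by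
  induction args with
  | nil => simp [sumPts, ptVal]
  | cons a rest ih =>
    rw [sumPts, ptVal_append, ptVal_map_smul, ptVal_opPts hW a.2 (hc a (by simp)),
      ih fun b hb => hc b (by simp [hb]), List.map_cons, List.sum_cons]

/-- Gates: value = sum of parse trees (no constants, products of fan-in 1 or 2).
[cite: LagardeLimayeSrinivasan2018, §2] -/
theorem ptVal_gatePts {W : List (List (Shape × FreeAlgebra R σ))} {vals : List (FreeAlgebra R σ)}
    (hW : ∀ j, ptVal (W.getD j []) = vals.getD j 0) (g : Gate R σ)
    (hc : ∀ u ∈ g.args, ∀ c, u ≠ Operand.const c)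
    (hp : ∀ args, g = Gate.prod args → args.length = 1 ∨ args.length = 2) :
    ptVal (gatePts W g) = g.ncEval vals := by
  rcases g with args | (_ | ⟨u, _ | ⟨u', _ | _⟩⟩)
  · exact ptVal_sumPts hW args fun a ha => hc a.2 (by
      simp only [Gate.args]; exact List.mem_map.2 ⟨a, ha, rfl⟩)
  · rcases hp [] rfl with h | h <;> simp only [List.length_nil] at h <;> omega
  · simp only [gatePts, Gate.ncEval, List.map_cons, List.map_nil, List.prod_cons, List.prod_nil,
      mul_one]
    exact ptVal_opPts hW u (hc u (by simp [Gate.args]))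
  · simp only [gatePts, Gate.ncEval, List.map_cons, List.map_nil, List.prod_cons, List.prod_nil,
      mul_one]
    rw [ptVal_pairPts, ptVal_opPts hW u (hc u (by simp [Gate.args])),
      ptVal_opPts hW u' (hc u' (by simp [Gate.args]))]
  · rcases hp _ rfl with h | h <;> simp only [List.length_cons] at h <;> omega

/-- Gate lists: slot by slot. [cite: LagardeLimayeSrinivasan2018, §2] -/
theorem ptVal_ptLists (gs : List (Gate R σ))
    (hc : ∀ g ∈ gs, ∀ u ∈ g.args, ∀ c, u ≠ Operand.const c)
    (hp : ∀ args, Gate.prod args ∈ gs → args.length = 1 ∨ args.length = 2) (j : ℕ) :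
    ptVal ((ptLists gs).getD j []) = (ncGateValues gs).getD j 0 := by
  induction gs using List.reverseRecOn generalizing j with
  | nil => simp [ptLists, ncGateValues, ptVal]
  | append_singleton gs g ih =>
    have ih' : ∀ j, ptVal ((ptLists gs).getD j []) = (ncGateValues gs).getD j 0 := fun j =>
      ih (fun g' hg' => hc g' (List.mem_append_left _ hg'))
        (fun args h => hp args (List.mem_append_left _ h)) j
    rcases Nat.lt_trichotomy j gs.length with hj | rfl | hj
    · rw [ptLists_getD_append gs [g] hj, (ncGateValues_append_getD gs [g]).2 j hj, ih' j]
    · rw [ncGateValues_getD_length, ptLists_append_singleton,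
        List.getD_append_right _ _ _ _ (length_ptLists gs).le, length_ptLists, Nat.sub_self,
        List.getD_cons_zero]
      exact ptVal_gatePts ih' g (hc g (by simp)) fun args h => hp args (by rw [← h]; simp)
    · have h1 : (ptLists (gs ++ [g])).length ≤ j := by
        rw [length_ptLists, List.length_append, List.length_singleton]; omega
      have h2 : (ncGateValues (gs ++ [g])).length ≤ j := by
        rw [(ncGateValues_append_getD gs [g]).1, List.length_singleton]; omega
      rw [List.getD_eq_default _ _ h1, List.getD_eq_default _ _ h2]; simp [ptVal]

/-- ★ **SOUNDNESS** (LLS18 §2: «the polynomial computed by C is the sum of all monomials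
computed by parse formulas of C»), for circuits without `const` operands whose product gates
have fan-in 1 or 2. MODEL (module docstring): product fan-in 1 or 2 only (unary = copy), NO
`const` operands, product fan-in ≥ 3 NOT covered (= (c)); the F4 transfers are WEAKER in
constant than the typed rungs; NOT a new lower bound; 0 S-currency; closes NO item; A_nc
stmt-23446 / `PerNotNcVP` / VP ≠ VNP untouched. [cite: LagardeLimayeSrinivasan2018, §2] -/
theorem ptVal_circuitPts (P : ArithCircuit R σ)
    (hc : ∀ g ∈ P.gates, ∀ u ∈ g.args, ∀ c, u ≠ Operand.const c)
    (hp : ∀ args, Gate.prod args ∈ P.gates → args.length = 1 ∨ args.length = 2)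
    (ho : ∀ c, P.output ≠ Operand.const c) : ptVal (circuitPts P) = P.ncEval :=
  ptVal_opPts (ptVal_ptLists P.gates hc hp) P.output ho

/-- K6(i) witness `P₀ = xyz+zxy`: rotUPT, not UPT in print. [cite: LagardeLimayeSrinivasan2018] -/
theorem circuitPts_P0 (x y z : σ) :
    (circuitPts (⟨[Gate.prod [.var x, .var y], .prod [.gate 0, .var z], .prod [.var z, .gate 0],
        .sum [(1, .gate 1), (1, .gate 2)]], .gate 3⟩ : ArithCircuit R σ)).map Prod.fst =
      [Shape.node (.node .leaf .leaf) .leaf, .node .leaf (.node .leaf .leaf)] ∧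
    rotSim true (.node .leaf (.node .leaf .leaf)) (.node (.node .leaf .leaf) .leaf) = true ∧
    Shape.node .leaf (.node .leaf .leaf) ≠ .node (.node .leaf .leaf) .leaf :=
  ⟨by simp [circuitPts, ptLists, gatePts, pairPts, opPts, sumPts], by simp [rotSim], by simp⟩

/-! ### §2 Filtered values (the algebra behind the conversion) -/

/-- Filtered values add. [cite: LagardeLimayeSrinivasan2018, §4] -/
theorem ptValAt_append (rot : Bool) (S : Shape) (L M : List (Shape × FreeAlgebra R σ)) :
    ptValAt rot S (L ++ M) = ptValAt rot S L + ptValAt rot S M := by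
  simp [ptValAt, List.map_append, List.sum_append]

/-- Filtered values are linear in the weights. [cite: LagardeLimayeSrinivasan2018, §4] -/
theorem ptValAt_map_smul (rot : Bool) (S : Shape) (c : R) (L : List (Shape × FreeAlgebra R σ)) :
    ptValAt rot S (L.map fun e => (e.1, c • e.2)) = c • ptValAt rot S L := by
  induction L with
  | nil => simp [ptValAt]
  | cons e L ih =>
    simp only [ptValAt, List.map_cons, List.sum_cons] at ih ⊢
    rw [ih, smul_add, smul_ite, smul_zero]

/-- Filtered value of a weighted sum. [cite: LagardeLimayeSrinivasan2018, §4] -/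
theorem ptValAt_sumPts (rot : Bool) (S : Shape) (W : List (List (Shape × FreeAlgebra R σ)))
    (args : List (R × Operand R σ)) : ptValAt rot S (sumPts W args) =
      (args.map fun a => a.1 • ptValAt rot S (opPts W a.2)).sum := by
  induction args with
  | nil => simp [sumPts, ptValAt]
  | cons a rest ih =>
    rw [sumPts, ptValAt_append, ptValAt_map_smul, ih, List.map_cons, List.sum_cons]

/-- If every tree passes the filter, the filtered value is the value.
[cite: LagardeLimayeSrinivasan2018, §4] -/
theorem ptValAt_eq_ptVal {rot : Bool} {S : Shape} {L : List (Shape × FreeAlgebra R σ)}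
    (h : ∀ e ∈ L, rotSim rot e.1 S = true) : ptValAt rot S L = ptVal L := by
  induction L with
  | nil => simp [ptValAt, ptVal]
  | cons e L ih =>
    have h1 : rotSim rot e.1 S = true := h e (by simp)
    have h2 := ih fun e' he' => h e' (by simp [he'])
    simp only [ptValAt, ptVal, List.map_cons, List.sum_cons] at h2 ⊢
    rw [h1, if_pos rfl, h2]

/-- No product has a leaf shape. [cite: LagardeLimayeSrinivasan2018, §4] -/
theorem ptValAt_pairPts_leaf (rot : Bool) (L M : List (Shape × FreeAlgebra R σ)) :
    ptValAt rot .leaf (pairPts L M) = 0 := by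
  induction L with
  | nil => simp [pairPts, ptValAt]
  | cons e L ih =>
    rw [pairPts, ptValAt_append, ih, add_zero]
    clear ih
    induction M with
    | nil => simp [ptValAt]
    | cons f M ihM => simpa [ptValAt, rotSim] using ihM

/-- Helper: one pair against the filter at a node. [cite: LagardeLimayeSrinivasan2018, §4] -/
theorem pair_entry (rot : Bool) (l r A B : Shape) (x y : FreeAlgebra R σ) :
    (if rotSim rot (.node A B) (.node l r) = true then x * y else 0) =
      (if rotSim rot A l = true then x else 0) * (if rotSim rot B r = true then y else 0) +
      (if (rot && !(rotSim rot l r)) = true then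
        (if rotSim rot A r = true then x else 0) * (if rotSim rot B l = true then y else 0)
      else 0) := by
  have k1 := fun h1 h2 => sim_trans rot (A := l) (B := A) (C := r) ((sim_symm rot l A).trans h1) h2
  have k2 := fun hs h2 => sim_trans rot (A := A) (B := r) (C := l) h2 ((sim_symm rot r l).trans hs)
  have k3 := fun hs h2 => sim_trans rot (A := B) (B := l) (C := r) h2 hs
  rcases Bool.eq_false_or_eq_true (rotSim rot A l) with h1 | h1 <;>
    rcases Bool.eq_false_or_eq_true (rotSim rot B r) with h2 | h2 <;>
    rcases Bool.eq_false_or_eq_true (rotSim rot A r) with h3 | h3 <;>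
    rcases Bool.eq_false_or_eq_true (rotSim rot B l) with h4 | h4 <;>
    rcases Bool.eq_false_or_eq_true (rotSim rot l r) with hs | hs <;> cases rot <;>
    simp_all [rotSim]

/-- Helper: the pairs of one left entry at a node. [cite: LagardeLimayeSrinivasan2018, §4] -/
theorem ptValAt_map_pair (rot : Bool) (l r : Shape) (e : Shape × FreeAlgebra R σ)
    (M : List (Shape × FreeAlgebra R σ)) :
    ptValAt rot (.node l r) (M.map fun f => (Shape.node e.1 f.1, e.2 * f.2)) =
      (if rotSim rot e.1 l = true then e.2 else 0) * ptValAt rot r M +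
      (if (rot && !(rotSim rot l r)) = true then
        (if rotSim rot e.1 r = true then e.2 else 0) * ptValAt rot l M else 0) := by
  induction M with
  | nil => simp [ptValAt]
  | cons f M ih =>
    simp only [ptValAt, List.map_cons, List.sum_cons] at ih ⊢
    rw [ih, pair_entry rot l r e.1 f.1 e.2 f.2, mul_add, mul_add, add_add_add_comm, ite_add_ite,
      add_zero]

/-- ★ **The product rule of filtered values**: at a node `(l, r)` the pairs filter into
`V_L(l)·V_M(r)`, plus — with rotations, and only when `l ≁ r` (else the two cases coincide) —
`V_L(r)·V_M(l)`. MODEL (module docstring): product fan-in 1 or 2 only, NO `const` operands,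
fan-in ≥ 3 NOT covered; transfers WEAKER in constant than the typed rungs;
NOT a new lower bound; 0 S-currency; closes NO item; A_nc stmt-23446 / `PerNotNcVP` / VP ≠ VNP
untouched. [cite: LagardeLimayeSrinivasan2018, §4] -/
theorem ptValAt_pairPts_node (rot : Bool) (l r : Shape) (L M : List (Shape × FreeAlgebra R σ)) :
    ptValAt rot (.node l r) (pairPts L M) = ptValAt rot l L * ptValAt rot r M +
      (if (rot && !(rotSim rot l r)) = true then ptValAt rot r L * ptValAt rot l M else 0) := by
  induction L with
  | nil => simp [pairPts, ptValAt]
  | cons e L ih =>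
    rw [pairPts, ptValAt_append, ih, ptValAt_map_pair, add_add_add_comm, ite_add_ite, add_zero]
    simp only [ptValAt, List.map_cons, List.sum_cons, add_mul]

/-! ### §3 Typing of converted operands and slots -/

/-- Types of the slots. [cite: LagardeLimayeSrinivasan2018, §3 Proposition 7] -/
theorem nfTy_slot (T : Shape) (j i b : ℕ) (hi : i < (nodes T).length) (hb : b < 2) :
    nfTy T (3 * (nodes T).length * j + 2 * i + b) = (nodes T).getD i [] ∧
      nfTy T (sref (nodes T).length j i) = (nodes T).getD i [] := by
  have e1 : (3 * (nodes T).length * j + 2 * i + b) % (3 * (nodes T).length) = 2 * i + b := by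
    rw [Nat.add_assoc, Nat.mul_add_mod, Nat.mod_eq_of_lt (by omega)]
  have e2 : (3 * (nodes T).length * j + 2 * (nodes T).length + i) % (3 * (nodes T).length) =
      2 * (nodes T).length + i := by
    rw [Nat.add_assoc, Nat.mul_add_mod, Nat.mod_eq_of_lt (by omega)]
  have c1 : 2 * i + b < 2 * (nodes T).length := by omega
  have c2 : ¬ 2 * (nodes T).length + i < 2 * (nodes T).length := by omega
  unfold nfTy sref
  rw [e1, e2, if_pos c1, if_neg c2, show (2 * i + b) / 2 = i by omega, Nat.add_sub_cancel_left]
  exact ⟨rfl, rfl⟩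

/-- Converted operands are typed. [cite: LagardeLimayeSrinivasan2018, §3 Proposition 7] -/
theorem opConv_typed (T : Shape) (j : ℕ) {π : List Bool} (hπ : π ∈ nodes T)
    (u : Operand R σ) : OpTyped T (nfTy T) π (opConv T j π u) := by
  cases u with
  | var x =>
    simp only [opConv]
    split
    · next h => exact OpTyped.var h
    · exact OpTyped.zero
  | const c => exact OpTyped.zero
  | gate j' =>
    simp only [opConv]
    split
    · have hi := List.idxOf_lt_length_of_mem hπ
      refine OpTyped.gate ((nfTy_slot T j' _ 0 hi (by omega)).2.trans ?_)
      rw [List.getD_eq_getElem _ _ hi, List.getElem_idxOf hi]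
    · exact OpTyped.zero

/-- Product slots are rot-typed; without rotations, typed.
[cite: LagardeLimayeSrinivasan2018, §4] -/
theorem pslot_rot (rot : Bool) (T : Shape) (j : ℕ) {i : ℕ} (hi : i < (nodes T).length) (b : ℕ)
    (g : Gate R σ) : GateRot T (nfTy T) ((nodes T).getD i []) (pslot rot T j i b g) ∧
      GateTyped T (nfTy T) ((nodes T).getD i []) (pslot false T j i b g) := by
  have hm : ∀ {l r : Shape} (c : Bool), T.sub ((nodes T).getD i []) = some (.node l r) →
      (nodes T).getD i [] ++ [c] ∈ nodes T := fun c h =>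
    mem_nodes_iff.2 (by rw [Shape.sub_sub h]; cases c <;> simp [Shape.sub, Shape.sub_nil])
  have hπ : (nodes T).getD i [] ∈ nodes T := by
    rw [List.getD_eq_getElem _ _ hi]; exact List.getElem_mem hi
  have h0 : GateRot T (nfTy T) ((nodes T).getD i []) (.sum ([] : List (R × Operand R σ))) ∧
      GateTyped T (nfTy T) ((nodes T).getD i []) (.sum ([] : List (R × Operand R σ))) :=
    ⟨GateRot.sum (by simp), GateTyped.sum (by simp)⟩
  rcases g with args | (_ | ⟨u, _ | ⟨u', _ | _⟩⟩) <;> try exact h0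
  cases hT : T.sub ((nodes T).getD i []) with
  | none => obtain ⟨S, hS⟩ := mem_nodes_iff.1 hπ; rw [hT] at hS; cases hS
  | some S =>
    cases S with
    | leaf => simp only [pslot, hT]; exact h0
    | node l r =>
      simp only [pslot, hT]
      rcases Nat.eq_zero_or_pos b with rfl | hb
      · rw [if_pos rfl, if_pos rfl]
        exact ⟨.mul hT (opConv_typed T j (hm false hT) u) (opConv_typed T j (hm true hT) u'),
          .mul hT (opConv_typed T j (hm false hT) u) (opConv_typed T j (hm true hT) u')⟩
      · simp only [hb.ne', if_false, Bool.false_and, Bool.false_eq_true]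
        refine ⟨?_, h0.2⟩
        split
        · exact .rot hT (opConv_typed T j (hm true hT) u) (opConv_typed T j (hm false hT) u')
        · exact h0.1

/-- Sum slots are typed. [cite: LagardeLimayeSrinivasan2018, §3 Proposition 7] -/
theorem sslot_typed (T : Shape) (j : ℕ) {i : ℕ} (hi : i < (nodes T).length) (g : Gate R σ) :
    GateTyped T (nfTy T) ((nodes T).getD i []) (sslot T j i g) := by
  have hπ : (nodes T).getD i [] ∈ nodes T := by
    rw [List.getD_eq_getElem _ _ hi]; exact List.getElem_mem hi
  rcases g with args | (_ | ⟨u, _ | ⟨u', _ | _⟩⟩)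
  · refine GateTyped.sum fun a ha => ?_
    obtain ⟨a', -, rfl⟩ := List.mem_map.1 ha
    exact opConv_typed T j hπ a'.2
  · exact GateTyped.sum (by simp)
  · exact GateTyped.sum (by simpa using opConv_typed T j hπ u)
  · refine GateTyped.sum fun a ha => ?_
    simp only [List.mem_cons, List.not_mem_nil, or_false] at ha
    rcases ha with rfl | rfl
    · exact OpTyped.gate (by simpa using (nfTy_slot T j i 0 hi (by omega)).1)
    · exact OpTyped.gate (nfTy_slot T j i 1 hi (by omega)).1
  · exact GateTyped.sum (by simp)

end Summit.ValiantsHypothesis.ValiantsHypothesis.Theorems.NcParseTreeValues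

end
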